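import Summits.BirchSwinnertonDyer.BirchSwinnertonDyer.Theorems.GenusKolyvaginAtTwoPowDvdShaCardAtTwoRTCrossPairShaTorsion
import Summits.BirchSwinnertonDyer.BirchSwinnertonDyer.Theorems.GenusKolyvaginAtTwoShaCardDvdPowAtTwoRTNormSharpPairing
import Summits.BirchSwinnertonDyer.BirchSwinnertonDyer.Theorems.GenusKolyvaginAtTwoPowDvdShaCardAtTwoRTLocalEigenDuality
import Summits.BirchSwinnertonDyer.BirchSwinnertonDyer.Theorems.GenusKolyvaginAtTwoPowDvdShaCardAtTwoRTLocalConjInvariance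
import Summits.BirchSwinnertonDyer.BirchSwinnertonDyer.Theorems.GenusKolyvaginAtTwoPowDvdShaCardAtTwoRTUnramifiedParametrization
import Summits.BirchSwinnertonDyer.BirchSwinnertonDyer.Theorems.GenusKolyvaginAtTwoPowDvdShaCardAtTwoRTRegularFrameAtTwo
import HarnessLib

/-!
# Route `GenusKolyvaginAtTwo`, crux U_T `ShaCardDvdPowAtTwoRT` (stmt-BirchSwinnertonDyer-23298; upper half
# `#Ш(E/K)[2^∞] ∣ 2^(2M₀)`) — THE SHARP RUNG CERTIFICATE AT 2: McCallum's Cassels–Tate certificate `B(x, y) ≠ 0` (Prop. 4.7 with one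
# surviving term, Thm. 5.4 (16)–(23)) holds at a deep inert Kolyvagin place iff `α + β ≥ M + 1`, with `2^α` the order of the NORM of the
# test class's Kummer lift — no lost bit unless that norm drops

Seat `bsd-line-gk2-p3` g25 (PROVER seat 3/3, cell `bsd-f1-sign2`), `--supports stmt-BirchSwinnertonDyer-23298` (helper; closes nothing).
THEOREMS ONLY (no definition, no named fact, no `sorry`).  BSD is NOT proved by any of this; neither is U_T, L_T nor any stub.

WHY (seat memo `Cruxes/ShaCardDvdPowAtTwoRT/Lines/norm-sharp-upper-gk2p3.md` §1–§2, §5/§7: the `K`-frame rungs of the proposed hybrid line for U_T).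
The UPPER half of Kolyvagin's structure theorem certifies `ord d_{M_k}(n_{k+1}) ≥ 2^{N_{k+1}}` by a NON-ZERO Cassels–Tate value which, after the
Čebotarev bookkeeping, is ONE local term of McCallum's Prop. 4.7 (tree: gk2-p4's `…RTCrossPairVanishing` / `…CrossPairShaTorsion` give the
VANISHING form).  This file gives the POSITIVE form and its exact order at 2:
* §1 `ctLevelPairing_eq_zmodToCircle_localTerm_of_forall_cases` — `ι`-free: if at every `v ≠ v₀` the first class is Kummer, or the second class
  localises to `0`, or the local term is known to vanish, then `B(x, y) = zmodToCircle(t_{v₀}(D))`; `ctLevelPairing_ne_zero_iff_localTerm_ne_zero`.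
* §2 `addOrderOf_invWeilPairing_kummer_eq_of_norm` (+ `_right`, `_of_level_eq`) — the norm-sharp law (`…ShaCardDvdPowAtTwoRTNormSharpPairing`,
  p740273) for a LOCAL Kummer class `Y ∈ 𝓛_λ` against the localisation of a global eigenclass, assembled on the regular frame:
  `addOrderOf inv_λ(Y ∪ₑ loc x) = 2^(α + β − M)`, `2^α` = order of the norm `Y + ε σ_* Y`, `2^β` = order of `loc x` modulo `𝓛_λ`.
* §3 **`addOrderOf_firstCase_localTerm_eq_of_norm`** / **`firstCase_localTerm_ne_zero_iff_of_norm`** — at Cassels–Tate level `m·m = 2^M`: the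
  local term `t_λ(D) = inv_λ(loc_λ b₁ ∪ₑ β′_λ)` at a deep inert own place of `b₁` (eigen, Kummer threshold `β`) has order `2^(α + β − M)`, with
  `2^α` the order of the NORM `β′_λ + s·σ_*β′_λ` of the test class's Kummer lift; it is non-zero iff `M + 1 ≤ α + β`.
* §4 **`ctLevelPairing_ne_zero_iff_of_norm`** — THE SHARP RUNG CERTIFICATE: with the side conditions of §1 at the other places,
  `B(x, y) ≠ 0 ⟺ M + 1 ≤ α + β`.  For a test class whose bottom bit is `τ`-fixed the norm drops one bit (McCallum's Lemma 5.3 at 2);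
  for `τ`-moved bottom bits the rung is as sharp as at odd `p`.

References: [McCallumLMS1991] §4 Prop. 4.7, §5 Lemma 5.3, Thm. 5.4 (16)–(23), Thm. 5.8; [MilneADT2006] I §6 proof of Prop. 6.9;
[Kolyvagin1991MathAnn] Thm. 2.1; [GrossLMS1991] §8 Prop. 8.1–8.2.
-/

set_option autoImplicit false

noncomputable section

open scoped Classical
open scoped AddSubgroup
open Function Field NumberField IsDedekindDomain WeierstrassCurve
open Literature.NumberTheory.EllipticCurves Literature.NumberTheory.GaloisRepresentations
open Literature.NumberTheory.GaloisCohomology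
open Literature.NumberTheory.GaloisRepresentations.DiscreteGaloisModule (mu)
open Literature.NumberTheory.Automorphic
open Summit.BirchSwinnertonDyer.Rank1Residual.X11b.Relaxation
open Summit.BirchSwinnertonDyer.Rank1Residual.JET.GlobalDuality

-- the Theorems namespace of this sub repeats the summit name by design (D-0017 nested layout)
set_option linter.dupNamespace false

universe u

namespace Summit.BirchSwinnertonDyer.BirchSwinnertonDyer.Theorems.GenusExact.PlusDescent

/-! ## §1 McCallum's Prop. 4.7 with one surviving term, `ι`-free -/

section OneTerm

variable {K : Type u} [Field K] [NumberField K] {W : WeierstrassCurve K} {m : ℕ} [NeZero m]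
variable (e : geomTorsion W ((m * m : ℕ) : ℤ) → geomTorsion W ((m * m : ℕ) : ℤ) → AlgebraicClosure K)
  (hμ : ∀ S T, e S T ^ (m * m) = 1)
  (hadd₁ : ∀ S₁ S₂ T, e (S₁ + S₂) T = e S₁ T * e S₂ T)
  (hadd₂ : ∀ S T₁ T₂, e S (T₁ + T₂) = e S T₁ * e S T₂)
  (hgal : ∀ (σ : absoluteGaloisGroup K) (S T : geomTorsion W ((m * m : ℕ) : ℤ)), σ • e S T = e (σ • S) (σ • T))
variable (inv : LocalInvariants K (m * m))
variable (halt : ∀ T, e T T = 1) (hPT' : inv.SumInvLocalizationEqZero)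
  (hH3 : ∀ c : galoisCohomology (mu K (m * m)) 3,
    (∀ v : Place K, galoisCohomology.localization (mu K (m * m)) v 3 c = 0) → c = 0)
  (hfin : ∀ D : GeneralCaseData W m e hμ hadd₁ hadd₂ hgal, ∃ S : Finset (Place K), ∀ v ∉ S, D.localTerm inv v = 0)

include halt hPT' in
/-- **`B(x, y)` is ONE local term** (McCallum's Prop. 4.7 with one surviving term, `ι`-free).  For `x, y ∈ Ш[m]` over Selmer classes
`z = m • b₁`, `t` at level `m²` and a first-case datum `D` (`D.b₁ = b₁`, `ι_* D.b′ = t`): if at every place `v ≠ v₀` either `loc_v b₁` is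
Kummer, or `loc_v b′ = 0`, or `t_v(D) = 0`, then `B(x, y) = zmodToCircle(t_{v₀}(D))`. [cite: McCallumLMS1991, §4 Prop. 4.7]
[cite: MilneADT2006, Ch. I §6, proof of Prop. 6.9] -/
theorem ctLevelPairing_eq_zmodToCircle_localTerm_of_forall_cases [NeZero (m * m)] [W.IsElliptic] (x y : (W.sha)[m])
    (z t : selmerGroup W ((m * m : ℕ) : ℤ))
    (hx : shaTorsionVal W m x = torsionH1ToH1 W ((m * m : ℕ) : ℤ) z) (hy : shaTorsionVal W m y = torsionH1ToH1 W ((m * m : ℕ) : ℤ) t)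
    {b₁ : galoisCohomology (W.torsionGaloisModule ((m * m : ℕ) : ℤ)) 1} (hz : (z : galH1Torsion W ((m * m : ℕ) : ℤ)) = (m : ℤ) • b₁)
    (D : FirstCaseData W m) (hD₁ : D.b₁ = b₁)
    (hDt : galoisCohomology.map (inclKD W m m) 1 D.b' = (t : galH1Torsion W ((m * m : ℕ) : ℤ))) (v₀ : Place K)
    (h : ∀ v : Place K, v ≠ v₀ →
      galoisCohomology.res (W.torsionGaloisModule ((m * m : ℕ) : ℤ)) (Place.Completion v) 1 b₁ ∈
          W.kummerLocalConditionAt ((m * m : ℕ) : ℤ) (Place.Completion v) ∨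
        galoisCohomology.res (W.torsionGaloisModule (m : ℤ)) (Place.Completion v) 1 D.b' = 0 ∨
          D.localTerm e hμ hadd₁ hadd₂ hgal inv v = 0) :
    ctLevelPairing W m e hμ hadd₁ hadd₂ hgal inv halt hPT' hH3 hfin x y =
      zmodToCircle (m * m) (D.localTerm e hμ hadd₁ hadd₂ hgal inv v₀) := by
  have hiso := GeneralCaseData.hiso_of_fact (W := W) (m := m) (e := e) (hμ := hμ) (hadd₁ := hadd₁) (hadd₂ := hadd₂)
    (hgal := hgal) halt
  rw [ctLevelPairing_apply, hx, hy, hz, ← hDt, torsionH1ToH1_map_inclKD, ← hD₁, ctGeneralFun_zsmul_eq_value inv halt hPT' D,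
    ← D.sum_localTerm_eq_value inv hiso (Finset.subset_insert v₀ D.badSet)]
  congr 1
  refine Finset.sum_eq_single_of_mem v₀ (Finset.mem_insert_self v₀ _) fun v _ hv ↦ ?_
  rcases h v hv with h₁ | h₂ | h₃
  · exact D.localTerm_eq_zero_of_res_b₁_mem inv hiso (hD₁ ▸ h₁)
  · exact D.localTerm_eq_zero_of_res_b'_eq_zero inv h₂
  · exact h₃

include halt hPT' in
/-- **The certificate**: under the hypotheses of `ctLevelPairing_eq_zmodToCircle_localTerm_of_forall_cases`, `B(x, y) ≠ 0 ⟺ t_{v₀}(D) ≠ 0`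
(`ℤ/m² ↪ ℚ/ℤ` is injective). [cite: McCallumLMS1991, §5 proof of Thm. 5.4] -/
theorem ctLevelPairing_ne_zero_iff_localTerm_ne_zero [NeZero (m * m)] [W.IsElliptic] (x y : (W.sha)[m])
    (z t : selmerGroup W ((m * m : ℕ) : ℤ))
    (hx : shaTorsionVal W m x = torsionH1ToH1 W ((m * m : ℕ) : ℤ) z) (hy : shaTorsionVal W m y = torsionH1ToH1 W ((m * m : ℕ) : ℤ) t)
    {b₁ : galoisCohomology (W.torsionGaloisModule ((m * m : ℕ) : ℤ)) 1} (hz : (z : galH1Torsion W ((m * m : ℕ) : ℤ)) = (m : ℤ) • b₁)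
    (D : FirstCaseData W m) (hD₁ : D.b₁ = b₁)
    (hDt : galoisCohomology.map (inclKD W m m) 1 D.b' = (t : galH1Torsion W ((m * m : ℕ) : ℤ))) (v₀ : Place K)
    (h : ∀ v : Place K, v ≠ v₀ →
      galoisCohomology.res (W.torsionGaloisModule ((m * m : ℕ) : ℤ)) (Place.Completion v) 1 b₁ ∈
          W.kummerLocalConditionAt ((m * m : ℕ) : ℤ) (Place.Completion v) ∨
        galoisCohomology.res (W.torsionGaloisModule (m : ℤ)) (Place.Completion v) 1 D.b' = 0 ∨
          D.localTerm e hμ hadd₁ hadd₂ hgal inv v = 0) :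
    ctLevelPairing W m e hμ hadd₁ hadd₂ hgal inv halt hPT' hH3 hfin x y ≠ 0 ↔ D.localTerm e hμ hadd₁ hadd₂ hgal inv v₀ ≠ 0 := by
  rw [ctLevelPairing_eq_zmodToCircle_localTerm_of_forall_cases e hμ hadd₁ hadd₂ hgal inv halt hPT' hH3 hfin x y z t hx hy hz D hD₁ hDt v₀ h]
  exact not_congr (map_eq_zero_iff _ (zmodToCircle_injective (m * m)))

end OneTerm

/-! ## §2 The norm-sharp law for a local Kummer class, assembled -/

section Kolyvagin

variable (W : WeierstrassCurve ℚ) (K : Type) [Field K] [NumberField K] [W.IsElliptic] [W.IsGloballyMinimal]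

/-- **THE NORM-SHARP LAW for a LOCAL Kummer class (assembled).**  `K` imaginary quadratic, `τ ≠ 1`, `τ² = 1`; `E/ℚ` globally minimal, `Δ < 0`;
`ℓ` Zhang–Kolyvagin at `2`, `1 ≤ M ≤ M(ℓ)`, `FrobEqFrobInfty W K (2^M) ℓ`; `λ ∋ ℓ`, `τ•λ = λ`; `e` lift-equivariant, `inv` injective at `λ` and
conj-compatible.  For a global `x` with `τ_* x = εx` and «`2^j loc_λ x` Kummer `⟺ β ≤ j`», and a LOCAL Kummer class `Y ∈ 𝓛_λ` with
«`2^j (Y + ε σ_* Y) = 0 ⟺ α ≤ j`» (the order of its NORM): **`addOrderOf inv_λ(Y ∪ₑ loc_λ x) = 2^(α + β − M)`**.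
[cite: McCallumLMS1991, §5 Lemma 5.3 and proof of Thm. 5.4] [cite: Kolyvagin1991MathAnn, Thm. 2.1] -/
theorem addOrderOf_invWeilPairing_kummer_eq_of_norm (hK : IsImaginaryQuadratic K) (hΔ : W.Δ < 0)
    {M ℓ : ℕ} (hM : 1 ≤ M)
    (hℓ : Zhang2014.IsKolyvaginPrime (W.conductorNorm ℤ) W K 2 ℓ) (hk : M ≤ Zhang2014.kolyvaginIndex W 2 ℓ)
    (hF : FrobEqFrobInfty W K (2 ^ M) ℓ) (w : HeightOneSpectrum (𝓞 K)) (hw : (ℓ : 𝓞 K) ∈ w.asIdeal)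
    {τ : K ≃ₐ[ℚ] K} (hτ1 : τ ≠ 1) (hττ : τ * τ = 1) (hfix : τ • w = w)
    (e : (W.baseChange K).geomTorsion ((2 ^ M : ℕ) : ℤ) → (W.baseChange K).geomTorsion ((2 ^ M : ℕ) : ℤ) → AlgebraicClosure K)
    (hμ : ∀ S T, e S T ^ (2 ^ M) = 1)
    (hadd₁ : ∀ S₁ S₂ T, e (S₁ + S₂) T = e S₁ T * e S₂ T)
    (hadd₂ : ∀ S T₁ T₂, e S (T₁ + T₂) = e S T₁ * e S T₂)
    (hgal : ∀ (γ : absoluteGaloisGroup K) (S T : (W.baseChange K).geomTorsion ((2 ^ M : ℕ) : ℤ)), γ • e S T = e (γ • S) (γ • T))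
    (halt : ∀ T, e T T = 1) (hnondeg : ∀ T, (∀ S, e S T = 1) → T = 0)
    (hte : ∀ S T, e ((isLiftOfAut_liftAutPlace τ hfix).torsionMap W ((2 ^ M : ℕ) : ℤ) S)
      ((isLiftOfAut_liftAutPlace τ hfix).torsionMap W ((2 ^ M : ℕ) : ℤ) T) = liftAutPlace τ hfix (e S T))
    (inv : LocalInvariants K (2 ^ M)) (hinj : Injective (inv (Sum.inr w))) (hinvc : inv.IsConjCompatible τ)
    {x : galoisCohomology ((W.baseChange K).torsionGaloisModule ((2 ^ M : ℕ) : ℤ)) 1} {ε : ℤ} (hε : ε = 1 ∨ ε = -1)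
    (hx : conjAct W τ ((2 ^ M : ℕ) : ℤ) x = ε • x)
    {Y : galoisCohomology (((W.baseChange K).torsionGaloisModule ((2 ^ M : ℕ) : ℤ)).toLocal (Sum.inr w : Place K)) 1}
    (hY : Y ∈ (W.baseChange K).kummerSelmerStructure ((2 ^ M : ℕ) : ℤ) (Sum.inr w))
    {α β : ℕ} (hα : ∀ j : ℕ, (2 ^ j) • (Y + ε • conjActPlace W τ ((2 ^ M : ℕ) : ℤ) hfix Y) = 0 ↔ α ≤ j)
    (hβ : ∀ j : ℕ, (2 ^ j) • galoisCohomology.localization ((W.baseChange K).torsionGaloisModule ((2 ^ M : ℕ) : ℤ))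
      (Sum.inr w : Place K) 1 x ∈ (W.baseChange K).kummerSelmerStructure ((2 ^ M : ℕ) : ℤ) (Sum.inr w) ↔ β ≤ j) :
    addOrderOf (invWeilPairing (W.baseChange K) (2 ^ M) e hμ hadd₁ hadd₂ hgal inv (Sum.inr w) Y
        (galoisCohomology.localization ((W.baseChange K).torsionGaloisModule ((2 ^ M : ℕ) : ℤ)) (Sum.inr w : Place K) 1 x)) =
      2 ^ (α + β - M) := by
  haveI : Fact (Nat.Prime 2) := ⟨Nat.prime_two⟩
  have hM0 : M ≠ 0 := by omega
  set loc := galoisCohomology.localization ((W.baseChange K).torsionGaloisModule ((2 ^ M : ℕ) : ℤ)) (Sum.inr w : Place K) 1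
    with hloc
  set σ := conjActPlace W τ ((2 ^ M : ℕ) : ℤ) hfix with hσdef
  set t := (isLiftOfAut_liftAutPlace τ hfix).torsionMap W ((2 ^ M : ℕ) : ℤ) with htdef
  set b := invWeilPairing (W.baseChange K) (2 ^ M) e hμ hadd₁ hadd₂ hgal inv (Sum.inr w) with hb
  obtain ⟨hgood, hpw⟩ := hasGoodReductionAt_of_zhangKolyvaginPrime W K hℓ w hw 1
  have hpw' : ((2 : ℕ) : 𝓞 K) ∉ w.asIdeal := by rwa [pow_one, Int.cast_natCast] at hpw
  have hσ : ∀ X, σ (σ X) = X := fun X ↦ conjActPlace_conjActPlace_self W τ (2 ^ M) hττ hfix X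
  have hσb := invWeilPairing_conjActPlace_self W τ (2 ^ M) e hμ hadd₁ hadd₂ hgal hfix hte inv hinvc
  obtain ⟨unr, hunr0, hunrL, hLunr, hunr⟩ :=
    exists_unramified_parametrization_kummer W K hK hℓ hk w hw hpw' hgood τ hfix
  obtain ⟨Q₀, htor, hspan, hfree, ht⟩ := exists_regular_frame_liftAutPlace W K hK hΔ hM hℓ hk hF w hw hτ1 hfix
  obtain ⟨Q, hQ⟩ := hLunr _ hY
  have hσx : σ (loc x) = ε • loc x := conjActPlace_localization_of_eigen W τ (2 ^ M) hfix hε hx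
  have hX : σ (loc x) = loc x ∨ σ (loc x) = -loc x := by
    rcases hε with rfl | rfl
    · left; rwa [one_zsmul] at hσx
    · right; rwa [neg_one_zsmul] at hσx
  have hnorm : Y + ε • σ Y = unr (Q + ε • t Q) := by rw [← hQ, map_add, map_zsmul, hunr]
  have hαQ : addOrderOf (Q + ε • t Q) = 2 ^ α := by
    rw [← addOrderOf_unr_eq (W.baseChange K) M w unr hunr0 (Q + ε • t Q), ← hnorm]
    exact addOrderOf_eq_two_pow_of_forall_iff hα
  have hPy : addOrderOf ((b.comp unr) Q₀ (loc x)) = 2 ^ β := by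
    rw [AddMonoidHom.comp_apply]
    exact addOrderOf_invWeilPairing_unr_basis_eq (W.baseChange K) M e hμ hadd₁ hadd₂ hgal halt hnondeg w inv hinj t σ hσ hσb unr
      hunr hunrL hLunr Q₀ hspan hM0 hX hβ
  have hinv' : ∀ (u : (W.baseChange K).geomTorsion ((2 ^ M : ℕ) : ℤ))
      (y : galoisCohomology (((W.baseChange K).torsionGaloisModule ((2 ^ M : ℕ) : ℤ)).toLocal (Sum.inr w)) 1),
      (b.comp unr) (t u) (σ y) = (b.comp unr) u y := fun u y ↦ by
    rw [AddMonoidHom.comp_apply, AddMonoidHom.comp_apply, hunr, hσb]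
  rw [← hQ, show b (unr Q) (loc x) = (b.comp unr) Q (loc x) from rfl]
  rcases hε with rfl | rfl
  · rw [one_zsmul] at hαQ hσx
    exact normSharp_addOrderOf_pairing_of_fixed_of_basis t ht σ hσ (b.comp unr) hinv' Q₀ hspan hfree htor hσx hαQ hPy
  · rw [neg_one_zsmul, ← sub_eq_add_neg] at hαQ
    rw [neg_one_zsmul] at hσx
    exact normSharp_addOrderOf_pairing_of_antifixed_of_basis t ht σ hσ (b.comp unr) hinv' Q₀ hspan hfree htor hσx hαQ hPy

/-- **The norm-sharp law for a local Kummer class, flipped** (`loc x` on the left). [cite: McCallumLMS1991, §5 Lemma 5.3] -/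
theorem addOrderOf_invWeilPairing_kummer_eq_of_norm_right (hK : IsImaginaryQuadratic K) (hΔ : W.Δ < 0)
    {M ℓ : ℕ} (hM : 1 ≤ M)
    (hℓ : Zhang2014.IsKolyvaginPrime (W.conductorNorm ℤ) W K 2 ℓ) (hk : M ≤ Zhang2014.kolyvaginIndex W 2 ℓ)
    (hF : FrobEqFrobInfty W K (2 ^ M) ℓ) (w : HeightOneSpectrum (𝓞 K)) (hw : (ℓ : 𝓞 K) ∈ w.asIdeal)
    {τ : K ≃ₐ[ℚ] K} (hτ1 : τ ≠ 1) (hττ : τ * τ = 1) (hfix : τ • w = w)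
    (e : (W.baseChange K).geomTorsion ((2 ^ M : ℕ) : ℤ) → (W.baseChange K).geomTorsion ((2 ^ M : ℕ) : ℤ) → AlgebraicClosure K)
    (hμ : ∀ S T, e S T ^ (2 ^ M) = 1)
    (hadd₁ : ∀ S₁ S₂ T, e (S₁ + S₂) T = e S₁ T * e S₂ T)
    (hadd₂ : ∀ S T₁ T₂, e S (T₁ + T₂) = e S T₁ * e S T₂)
    (hgal : ∀ (γ : absoluteGaloisGroup K) (S T : (W.baseChange K).geomTorsion ((2 ^ M : ℕ) : ℤ)), γ • e S T = e (γ • S) (γ • T))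
    (halt : ∀ T, e T T = 1) (hnondeg : ∀ T, (∀ S, e S T = 1) → T = 0)
    (hte : ∀ S T, e ((isLiftOfAut_liftAutPlace τ hfix).torsionMap W ((2 ^ M : ℕ) : ℤ) S)
      ((isLiftOfAut_liftAutPlace τ hfix).torsionMap W ((2 ^ M : ℕ) : ℤ) T) = liftAutPlace τ hfix (e S T))
    (inv : LocalInvariants K (2 ^ M)) (hinj : Injective (inv (Sum.inr w))) (hinvc : inv.IsConjCompatible τ)
    {x : galoisCohomology ((W.baseChange K).torsionGaloisModule ((2 ^ M : ℕ) : ℤ)) 1} {ε : ℤ} (hε : ε = 1 ∨ ε = -1)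
    (hx : conjAct W τ ((2 ^ M : ℕ) : ℤ) x = ε • x)
    {Y : galoisCohomology (((W.baseChange K).torsionGaloisModule ((2 ^ M : ℕ) : ℤ)).toLocal (Sum.inr w : Place K)) 1}
    (hY : Y ∈ (W.baseChange K).kummerSelmerStructure ((2 ^ M : ℕ) : ℤ) (Sum.inr w))
    {α β : ℕ} (hα : ∀ j : ℕ, (2 ^ j) • (Y + ε • conjActPlace W τ ((2 ^ M : ℕ) : ℤ) hfix Y) = 0 ↔ α ≤ j)
    (hβ : ∀ j : ℕ, (2 ^ j) • galoisCohomology.localization ((W.baseChange K).torsionGaloisModule ((2 ^ M : ℕ) : ℤ))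
      (Sum.inr w : Place K) 1 x ∈ (W.baseChange K).kummerSelmerStructure ((2 ^ M : ℕ) : ℤ) (Sum.inr w) ↔ β ≤ j) :
    addOrderOf (invWeilPairing (W.baseChange K) (2 ^ M) e hμ hadd₁ hadd₂ hgal inv (Sum.inr w)
        (galoisCohomology.localization ((W.baseChange K).torsionGaloisModule ((2 ^ M : ℕ) : ℤ)) (Sum.inr w : Place K) 1 x) Y) =
      2 ^ (α + β - M) := by
  rw [invWeilPairing_comm (W.baseChange K) M e hμ hadd₁ hadd₂ hgal halt w inv]
  exact addOrderOf_invWeilPairing_kummer_eq_of_norm W K hK hΔ hM hℓ hk hF w hw hτ1 hττ hfix e hμ hadd₁ hadd₂ hgal halt hnondeg hte inv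
    hinj hinvc hε hx hY hα hβ

/-- The flipped law at a level `N = 2^M` given as a variable (to apply VERBATIM at the Cassels–Tate level `N = m·m`).
[cite: McCallumLMS1991, §5 Lemma 5.3] -/
theorem addOrderOf_invWeilPairing_kummer_eq_of_norm_right_of_level_eq {N : ℕ} [NeZero N] {M : ℕ} (hN : N = 2 ^ M)
    (hK : IsImaginaryQuadratic K) (hΔ : W.Δ < 0) {ℓ : ℕ} (hM : 1 ≤ M)
    (hℓ : Zhang2014.IsKolyvaginPrime (W.conductorNorm ℤ) W K 2 ℓ) (hk : M ≤ Zhang2014.kolyvaginIndex W 2 ℓ)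
    (hF : FrobEqFrobInfty W K (2 ^ M) ℓ) (w : HeightOneSpectrum (𝓞 K)) (hw : (ℓ : 𝓞 K) ∈ w.asIdeal)
    {τ : K ≃ₐ[ℚ] K} (hτ1 : τ ≠ 1) (hττ : τ * τ = 1) (hfix : τ • w = w)
    (e : (W.baseChange K).geomTorsion ((N : ℕ) : ℤ) → (W.baseChange K).geomTorsion ((N : ℕ) : ℤ) → AlgebraicClosure K)
    (hμ : ∀ S T, e S T ^ N = 1)
    (hadd₁ : ∀ S₁ S₂ T, e (S₁ + S₂) T = e S₁ T * e S₂ T)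
    (hadd₂ : ∀ S T₁ T₂, e S (T₁ + T₂) = e S T₁ * e S T₂)
    (hgal : ∀ (γ : absoluteGaloisGroup K) (S T : (W.baseChange K).geomTorsion ((N : ℕ) : ℤ)), γ • e S T = e (γ • S) (γ • T))
    (halt : ∀ T, e T T = 1) (hnondeg : ∀ T, (∀ S, e S T = 1) → T = 0)
    (hte : ∀ S T, e ((isLiftOfAut_liftAutPlace τ hfix).torsionMap W ((N : ℕ) : ℤ) S)
      ((isLiftOfAut_liftAutPlace τ hfix).torsionMap W ((N : ℕ) : ℤ) T) = liftAutPlace τ hfix (e S T))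
    (inv : LocalInvariants K N) (hinj : Injective (inv (Sum.inr w))) (hinvc : inv.IsConjCompatible τ)
    {x : galoisCohomology ((W.baseChange K).torsionGaloisModule ((N : ℕ) : ℤ)) 1} {ε : ℤ} (hε : ε = 1 ∨ ε = -1)
    (hx : conjAct W τ ((N : ℕ) : ℤ) x = ε • x)
    {Y : galoisCohomology (((W.baseChange K).torsionGaloisModule ((N : ℕ) : ℤ)).toLocal (Sum.inr w : Place K)) 1}
    (hY : Y ∈ (W.baseChange K).kummerSelmerStructure ((N : ℕ) : ℤ) (Sum.inr w))
    {α β : ℕ} (hα : ∀ j : ℕ, (2 ^ j) • (Y + ε • conjActPlace W τ ((N : ℕ) : ℤ) hfix Y) = 0 ↔ α ≤ j)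
    (hβ : ∀ j : ℕ, (2 ^ j) • galoisCohomology.localization ((W.baseChange K).torsionGaloisModule ((N : ℕ) : ℤ))
      (Sum.inr w : Place K) 1 x ∈ (W.baseChange K).kummerSelmerStructure ((N : ℕ) : ℤ) (Sum.inr w) ↔ β ≤ j) :
    addOrderOf (invWeilPairing (W.baseChange K) N e hμ hadd₁ hadd₂ hgal inv (Sum.inr w)
        (galoisCohomology.localization ((W.baseChange K).torsionGaloisModule ((N : ℕ) : ℤ)) (Sum.inr w : Place K) 1 x) Y) =
      2 ^ (α + β - M) := by
  subst hN
  exact addOrderOf_invWeilPairing_kummer_eq_of_norm_right W K hK hΔ hM hℓ hk hF w hw hτ1 hττ hfix e hμ hadd₁ hadd₂ hgal halt hnondeg hte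
    inv hinj hinvc hε hx hY hα hβ

/-! ## §3 The order of McCallum's local term at a deep inert own place -/

/-- **THE ORDER OF THE LOCAL TERM `t_λ(D) = inv_λ(loc_λ b₁ ∪ₑ β′_λ)`** at Cassels–Tate level `m·m = 2^M`, at a deep inert Kolyvagin place `λ`
(`Δ < 0`, `1 ≤ M ≤ M(ℓ)`, `FrobEqFrobInfty W K (2^M) ℓ`, `τ•λ = λ`; `e` lift-equivariant, `inv` injective at `λ` and conj-compatible): for a
first-case datum `D` whose global lift `b₁` is a `τ_*`-eigenclass of sign `s` with «`2^j loc_λ b₁` Kummer `⟺ β ≤ j`» and whose Kummer lift `β′_λ`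
has NORM `β′_λ + s·σ_*β′_λ` of order `2^α`:  **`addOrderOf t_λ(D) = 2^(α + β − M)`**. [cite: McCallumLMS1991, §4 Prop. 4.7, §5 Lemma 5.3] -/
theorem addOrderOf_firstCase_localTerm_eq_of_norm {m M : ℕ} [NeZero m] [NeZero (m * m)] (hmm : m * m = 2 ^ M)
    (hK : IsImaginaryQuadratic K) (hΔ : W.Δ < 0) {ℓ : ℕ} (hM : 1 ≤ M)
    (hℓ : Zhang2014.IsKolyvaginPrime (W.conductorNorm ℤ) W K 2 ℓ) (hk : M ≤ Zhang2014.kolyvaginIndex W 2 ℓ)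
    (hF : FrobEqFrobInfty W K (2 ^ M) ℓ) (w : HeightOneSpectrum (𝓞 K)) (hw : (ℓ : 𝓞 K) ∈ w.asIdeal)
    {τ : K ≃ₐ[ℚ] K} (hτ1 : τ ≠ 1) (hττ : τ * τ = 1) (hfix : τ • w = w)
    (e : (W.baseChange K).geomTorsion ((m * m : ℕ) : ℤ) → (W.baseChange K).geomTorsion ((m * m : ℕ) : ℤ) → AlgebraicClosure K)
    (hμ : ∀ S T, e S T ^ (m * m) = 1)
    (hadd₁ : ∀ S₁ S₂ T, e (S₁ + S₂) T = e S₁ T * e S₂ T)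
    (hadd₂ : ∀ S T₁ T₂, e S (T₁ + T₂) = e S T₁ * e S T₂)
    (hgal : ∀ (γ : absoluteGaloisGroup K) (S T : (W.baseChange K).geomTorsion ((m * m : ℕ) : ℤ)), γ • e S T = e (γ • S) (γ • T))
    (halt : ∀ T, e T T = 1) (hnondeg : ∀ T, (∀ S, e S T = 1) → T = 0)
    (hte : ∀ S T, e ((isLiftOfAut_liftAutPlace τ hfix).torsionMap W ((m * m : ℕ) : ℤ) S)
      ((isLiftOfAut_liftAutPlace τ hfix).torsionMap W ((m * m : ℕ) : ℤ) T) = liftAutPlace τ hfix (e S T))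
    (inv : LocalInvariants K (m * m)) (hinj : Injective (inv (Sum.inr w))) (hinvc : inv.IsConjCompatible τ)
    (D : FirstCaseData (W.baseChange K) m) {s : ℤ} (hs : s = 1 ∨ s = -1)
    (hb₁ : conjAct W τ ((m * m : ℕ) : ℤ) D.b₁ = s • D.b₁)
    {α β : ℕ}
    (hβ : ∀ j : ℕ, (2 ^ j) • galoisCohomology.localization ((W.baseChange K).torsionGaloisModule ((m * m : ℕ) : ℤ))
      (Sum.inr w : Place K) 1 D.b₁ ∈ (W.baseChange K).kummerSelmerStructure ((m * m : ℕ) : ℤ) (Sum.inr w) ↔ β ≤ j)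
    {βw : galoisCohomology (((W.baseChange K).torsionGaloisModule ((m * m : ℕ) : ℤ)).toLocal (Sum.inr w : Place K)) 1}
    (hβw : βw = D.β' (Sum.inr w))
    (hα : ∀ j : ℕ, (2 ^ j) • (βw + s • conjActPlace W τ ((m * m : ℕ) : ℤ) hfix βw) = 0 ↔ α ≤ j) :
    addOrderOf (D.localTerm e hμ hadd₁ hadd₂ hgal inv (Sum.inr w)) = 2 ^ (α + β - M) := by
  have hβmem : βw ∈ (W.baseChange K).kummerSelmerStructure ((m * m : ℕ) : ℤ) (Sum.inr w) := hβw ▸ D.β'_mem (Sum.inr w)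
  rw [firstCase_localTerm_eq_invWeilPairing_localization e hμ hadd₁ hadd₂ hgal halt inv D (Sum.inr w)]
  have h := addOrderOf_invWeilPairing_kummer_eq_of_norm_right_of_level_eq W K hmm hK hΔ hM hℓ hk hF w hw hτ1 hττ hfix e hμ hadd₁ hadd₂
    hgal halt hnondeg hte inv hinj hinvc hs hb₁ hβmem hα hβ
  rwa [hβw] at h

/-- **The local term is non-zero iff `M + 1 ≤ α + β`** (same setting). [cite: McCallumLMS1991, §5 proof of Thm. 5.4] -/
theorem firstCase_localTerm_ne_zero_iff_of_norm {m M : ℕ} [NeZero m] [NeZero (m * m)] (hmm : m * m = 2 ^ M)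
    (hK : IsImaginaryQuadratic K) (hΔ : W.Δ < 0) {ℓ : ℕ} (hM : 1 ≤ M)
    (hℓ : Zhang2014.IsKolyvaginPrime (W.conductorNorm ℤ) W K 2 ℓ) (hk : M ≤ Zhang2014.kolyvaginIndex W 2 ℓ)
    (hF : FrobEqFrobInfty W K (2 ^ M) ℓ) (w : HeightOneSpectrum (𝓞 K)) (hw : (ℓ : 𝓞 K) ∈ w.asIdeal)
    {τ : K ≃ₐ[ℚ] K} (hτ1 : τ ≠ 1) (hττ : τ * τ = 1) (hfix : τ • w = w)
    (e : (W.baseChange K).geomTorsion ((m * m : ℕ) : ℤ) → (W.baseChange K).geomTorsion ((m * m : ℕ) : ℤ) → AlgebraicClosure K)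
    (hμ : ∀ S T, e S T ^ (m * m) = 1)
    (hadd₁ : ∀ S₁ S₂ T, e (S₁ + S₂) T = e S₁ T * e S₂ T)
    (hadd₂ : ∀ S T₁ T₂, e S (T₁ + T₂) = e S T₁ * e S T₂)
    (hgal : ∀ (γ : absoluteGaloisGroup K) (S T : (W.baseChange K).geomTorsion ((m * m : ℕ) : ℤ)), γ • e S T = e (γ • S) (γ • T))
    (halt : ∀ T, e T T = 1) (hnondeg : ∀ T, (∀ S, e S T = 1) → T = 0)
    (hte : ∀ S T, e ((isLiftOfAut_liftAutPlace τ hfix).torsionMap W ((m * m : ℕ) : ℤ) S)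
      ((isLiftOfAut_liftAutPlace τ hfix).torsionMap W ((m * m : ℕ) : ℤ) T) = liftAutPlace τ hfix (e S T))
    (inv : LocalInvariants K (m * m)) (hinj : Injective (inv (Sum.inr w))) (hinvc : inv.IsConjCompatible τ)
    (D : FirstCaseData (W.baseChange K) m) {s : ℤ} (hs : s = 1 ∨ s = -1)
    (hb₁ : conjAct W τ ((m * m : ℕ) : ℤ) D.b₁ = s • D.b₁)
    {α β : ℕ}
    (hβ : ∀ j : ℕ, (2 ^ j) • galoisCohomology.localization ((W.baseChange K).torsionGaloisModule ((m * m : ℕ) : ℤ))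
      (Sum.inr w : Place K) 1 D.b₁ ∈ (W.baseChange K).kummerSelmerStructure ((m * m : ℕ) : ℤ) (Sum.inr w) ↔ β ≤ j)
    {βw : galoisCohomology (((W.baseChange K).torsionGaloisModule ((m * m : ℕ) : ℤ)).toLocal (Sum.inr w : Place K)) 1}
    (hβw : βw = D.β' (Sum.inr w))
    (hα : ∀ j : ℕ, (2 ^ j) • (βw + s • conjActPlace W τ ((m * m : ℕ) : ℤ) hfix βw) = 0 ↔ α ≤ j) :
    D.localTerm e hμ hadd₁ hadd₂ hgal inv (Sum.inr w) ≠ 0 ↔ M + 1 ≤ α + β := by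
  have h := addOrderOf_firstCase_localTerm_eq_of_norm W K hmm hK hΔ hM hℓ hk hF w hw hτ1 hττ hfix e hμ hadd₁ hadd₂ hgal halt hnondeg hte inv
    hinj hinvc D hs hb₁ hβ hβw hα
  rw [Ne, ← AddMonoid.addOrderOf_eq_one_iff, h, Nat.pow_eq_one]
  omega

/-! ## §4 The sharp rung certificate -/

/-- **THE SHARP RUNG CERTIFICATE AT 2.**  Frame: `K` imaginary quadratic, `τ ≠ 1`, `τ² = 1`; `E/ℚ` globally minimal with `Δ < 0`; Cassels–Tate
level `m`, `m·m = 2^M`, `1 ≤ M`; `e`, `inv` at level `m·m` with the Cassels–Tate hypotheses, `inv` injective at `λ` and conj-compatible, `e`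
lift-equivariant at `λ`.  Data: `x, y ∈ Ш(E/K)[m]` over `z = m • b₁`, `t` and a first-case datum `D` (`D.b₁ = b₁` eigen of sign `s`, `ι_* D.b′ = t`);
`λ ∋ ℓ` a deep inert Kolyvagin place at which «`2^j loc_λ b₁` Kummer `⟺ β ≤ j`» and the NORM `β′_λ + s·σ_*β′_λ` of the test class's Kummer lift
has order `2^α`; at every OTHER place `loc b₁` is Kummer, or `loc b′ = 0`, or the term vanishes.  Then **`B(x, y) ≠ 0 ⟺ M + 1 ≤ α + β`** —
McCallum's certificate (Thm. 5.4 (16)–(23), Thm. 5.8) at `p = 2`, SHARP: the bit of Lemma 5.3 is lost only if the norm of `β′_λ` drops.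
[cite: McCallumLMS1991, §4 Prop. 4.7, §5 Lemma 5.3, Thm. 5.4, Thm. 5.8] [cite: MilneADT2006, Ch. I §6, proof of Prop. 6.9] -/
theorem ctLevelPairing_ne_zero_iff_of_norm {m M : ℕ} [NeZero m] [NeZero (m * m)] (hmm : m * m = 2 ^ M)
    (hK : IsImaginaryQuadratic K) (hΔ : W.Δ < 0) (hM : 1 ≤ M) {τ : K ≃ₐ[ℚ] K} (hτ1 : τ ≠ 1) (hττ : τ * τ = 1)
    (e : (W.baseChange K).geomTorsion ((m * m : ℕ) : ℤ) → (W.baseChange K).geomTorsion ((m * m : ℕ) : ℤ) → AlgebraicClosure K)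
    (hμ : ∀ S T, e S T ^ (m * m) = 1)
    (hadd₁ : ∀ S₁ S₂ T, e (S₁ + S₂) T = e S₁ T * e S₂ T)
    (hadd₂ : ∀ S T₁ T₂, e S (T₁ + T₂) = e S T₁ * e S T₂)
    (hgal : ∀ (γ : absoluteGaloisGroup K) (S T : (W.baseChange K).geomTorsion ((m * m : ℕ) : ℤ)), γ • e S T = e (γ • S) (γ • T))
    (halt : ∀ T, e T T = 1) (hnondeg : ∀ T, (∀ S, e S T = 1) → T = 0)
    (inv : LocalInvariants K (m * m)) (hinvc : inv.IsConjCompatible τ) (hPT' : inv.SumInvLocalizationEqZero)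
    (hH3 : ∀ c₃ : galoisCohomology (DiscreteGaloisModule.mu K (m * m)) 3,
      (∀ v : Place K, galoisCohomology.localization (DiscreteGaloisModule.mu K (m * m)) v 3 c₃ = 0) → c₃ = 0)
    (hfin : ∀ D : GeneralCaseData (W.baseChange K) m e hμ hadd₁ hadd₂ hgal, ∃ S : Finset (Place K), ∀ v ∉ S, D.localTerm inv v = 0)
    (x y : ((W.baseChange K).sha)[m]) (z t : selmerGroup (W.baseChange K) ((m * m : ℕ) : ℤ))
    (hx : shaTorsionVal (W.baseChange K) m x = torsionH1ToH1 (W.baseChange K) ((m * m : ℕ) : ℤ) z)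
    (hy : shaTorsionVal (W.baseChange K) m y = torsionH1ToH1 (W.baseChange K) ((m * m : ℕ) : ℤ) t)
    {b₁ : galoisCohomology ((W.baseChange K).torsionGaloisModule ((m * m : ℕ) : ℤ)) 1}
    (hz : (z : galH1Torsion (W.baseChange K) ((m * m : ℕ) : ℤ)) = (m : ℤ) • b₁)
    (D : FirstCaseData (W.baseChange K) m) (hD₁ : D.b₁ = b₁)
    (hDt : galoisCohomology.map (inclKD (W.baseChange K) m m) 1 D.b' = (t : galH1Torsion (W.baseChange K) ((m * m : ℕ) : ℤ)))
    {s : ℤ} (hs : s = 1 ∨ s = -1) (hb₁ : conjAct W τ ((m * m : ℕ) : ℤ) b₁ = s • b₁)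
    -- the new prime
    {ℓ : ℕ} (w : HeightOneSpectrum (𝓞 K)) (hℓ : Zhang2014.IsKolyvaginPrime (W.conductorNorm ℤ) W K 2 ℓ)
    (hk : M ≤ Zhang2014.kolyvaginIndex W 2 ℓ) (hF : FrobEqFrobInfty W K (2 ^ M) ℓ) (hw : (ℓ : 𝓞 K) ∈ w.asIdeal) (hfix : τ • w = w)
    (hte : ∀ S T, e ((isLiftOfAut_liftAutPlace τ hfix).torsionMap W ((m * m : ℕ) : ℤ) S)
      ((isLiftOfAut_liftAutPlace τ hfix).torsionMap W ((m * m : ℕ) : ℤ) T) = liftAutPlace τ hfix (e S T))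
    (hinj : Injective (inv (Sum.inr w)))
    {α β : ℕ}
    (hβ : ∀ j : ℕ, (2 ^ j) • galoisCohomology.localization ((W.baseChange K).torsionGaloisModule ((m * m : ℕ) : ℤ))
      (Sum.inr w : Place K) 1 b₁ ∈ (W.baseChange K).kummerSelmerStructure ((m * m : ℕ) : ℤ) (Sum.inr w) ↔ β ≤ j)
    {βw : galoisCohomology (((W.baseChange K).torsionGaloisModule ((m * m : ℕ) : ℤ)).toLocal (Sum.inr w : Place K)) 1}
    (hβw : βw = D.β' (Sum.inr w))
    (hα : ∀ j : ℕ, (2 ^ j) • (βw + s • conjActPlace W τ ((m * m : ℕ) : ℤ) hfix βw) = 0 ↔ α ≤ j)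
    -- the other places
    (hother : ∀ v : Place K, v ≠ (Sum.inr w : Place K) →
      galoisCohomology.res ((W.baseChange K).torsionGaloisModule ((m * m : ℕ) : ℤ)) (Place.Completion v) 1 b₁ ∈
          (W.baseChange K).kummerLocalConditionAt ((m * m : ℕ) : ℤ) (Place.Completion v) ∨
        galoisCohomology.res ((W.baseChange K).torsionGaloisModule (m : ℤ)) (Place.Completion v) 1 D.b' = 0 ∨
          D.localTerm e hμ hadd₁ hadd₂ hgal inv v = 0) :
    ctLevelPairing (W.baseChange K) m e hμ hadd₁ hadd₂ hgal inv halt hPT' hH3 hfin x y ≠ 0 ↔ M + 1 ≤ α + β := by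
  have hb₁' : conjAct W τ ((m * m : ℕ) : ℤ) D.b₁ = s • D.b₁ := by rw [hD₁]; exact hb₁
  have hβ' : ∀ j : ℕ, (2 ^ j) • galoisCohomology.localization ((W.baseChange K).torsionGaloisModule ((m * m : ℕ) : ℤ))
      (Sum.inr w : Place K) 1 D.b₁ ∈ (W.baseChange K).kummerSelmerStructure ((m * m : ℕ) : ℤ) (Sum.inr w) ↔ β ≤ j := by
    rw [hD₁]; exact hβ
  rw [ctLevelPairing_ne_zero_iff_localTerm_ne_zero e hμ hadd₁ hadd₂ hgal inv halt hPT' hH3 hfin x y z t hx hy hz D hD₁ hDt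
    (Sum.inr w : Place K) hother]
  exact firstCase_localTerm_ne_zero_iff_of_norm W K hmm hK hΔ hM hℓ hk hF w hw hτ1 hττ hfix e hμ hadd₁ hadd₂ hgal halt hnondeg hte inv
    hinj hinvc D hs hb₁' hβ' hβw hα

end Kolyvagin

end Summit.BirchSwinnertonDyer.BirchSwinnertonDyer.Theorems.GenusExact.PlusDescent

end
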